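import Literature.MathematicalPhysics.KineticTheory.FreeTransportDuhamel
import HarnessLib

/-!
# The averaged Duhamel operator `A_S` of velocity averaging and its adjoint

Topic: MathematicalPhysics / KineticTheory. Third file of a Fourier-free (real-space, `TT*`)
proof of the `L¹` velocity-averaging lemma (Cercignani–Illner–Pulvirenti 1994, Lemma 5.3.9,
`velocityAverage_relativelyCompact_L1` of `VelocityAveraging`). CIP (p. 155) reduce the lemma to
the compactness in `L²_loc` of the velocity averages `∫ uₙ dξ` of the solutions `uₙ` of
`T uₙ = Fₙ`, `uₙ|_{t=0} = 0`, for sources `Fₙ` bounded in `L^∞` with supports in a fixed compact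
set, and obtain it from the `H^{1/2}` bound of Lemma 5.3.8 (Fourier transform) and Rellich's
theorem. The files `VelocityAverageOperator`, `VelocityAverageKernel` and
`VelocityAverageCompact` replace this last step by an elementary real-space argument for the
**averaged Duhamel operator**

  `(A F)(t, x) = ∫ ψ₀(ξ) ∫_{0<s<S} F(t - s, x - sξ, ξ) ds dξ`

(`avgDuhamel ψ₀ S F`; by `sourceDuhamel_eq_setIntegral_Ioo` this *is* the velocity average
`∫ ψ₀ uₙ dξ` of `uₙ = sourceDuhamel Fₙ` on the slab `t ≤ S`): `A` commutes with space-time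
translations and `A A*` is the space-time convolution with an explicit `L¹` kernel
(`VelocityAverageKernel`), so that the translates of `A F` are equicontinuous in `L²` on `L^∞`-
bounded families with common compact support, and the Kolmogorov–Riesz criterion
(`Literature.Analysis.FunctionSpaces.exists_finset_eLpNorm_sub_lt_of_translate`) applies
(`VelocityAverageCompact`). This is the classical `TT*` route to averaging lemmas (the
"dispersion" point of view, Saint-Raymond 2009 §3.3.2; Bouchut–Desvillettes, *Averaging lemmas
without Fourier transform*, Proc. Roy. Soc. Edinburgh 129A (1999)); it proves compactness, not
the sharp `H^{1/2}` regularity.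

This file: the operator `A = avgDuhamel ψ₀ S` and its formal adjoint
`(A* G)(t', y, ξ) = ψ₀(ξ) ∫_{0<s<S} G(t' + s, y + sξ) ds` (`adjAvgDuhamel ψ₀ S G`) on bounded
measurable functions with bounded support; sup bounds, supports, measurability, translation
covariance, and the **adjoint identity** `∫ (A F) G = ∫ F (A* G)`
(`integral_avgDuhamel_mul_eq`: Fubini and the measure preservation of the lag shears).
Everything is proved.

## References

* C. Cercignani, R. Illner, M. Pulvirenti, *The Mathematical Theory of Dilute Gases*, Springer
  (1994), §5.3, proof of Lemma 5.3.9, p. 155. [CIP1994]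
* L. Saint-Raymond, *Hydrodynamic Limits of the Boltzmann Equation*, LNM 1971 (2009), §3.3.2
  (dispersive properties of free transport). [SaintRaymond2009]
-/

noncomputable section

open MeasureTheory Set Filter Function Metric
open _root_.Topology
open scoped ENNReal NNReal

namespace Literature.MathematicalPhysics.KineticTheory

/-! ## Bounded functions with bounded support are integrable -/

section Helpers

variable {X : Type*} [MeasurableSpace X] {μ : Measure X}

/-- A bounded a.e.-strongly measurable function vanishing off a set of finite measure is
integrable. [folklore] -/
theorem integrable_of_bounded_of_eq_zero {f : X → ℝ} (hf : AEStronglyMeasurable f μ) {C : ℝ}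
    (hC : ∀ x, |f x| ≤ C) {s : Set X} (hμs : μ s < ⊤) (h0 : ∀ x, x ∉ s → f x = 0) :
    Integrable f μ :=
  (Measure.integrableOn_of_bounded hμs.ne hf
    (ae_of_all _ fun x => (Real.norm_eq_abs _).le.trans (hC x))).integrable_of_forall_notMem_eq_zero
    h0

/-- For a product with a restricted second factor, almost every point has its second
coordinate in the restricting set. [folklore] -/
theorem ae_snd_mem_prod_restrict {Y : Type*} [MeasurableSpace Y] {ν : Measure Y} [SFinite ν]
    [SFinite μ] {I : Set Y} (hI : MeasurableSet I) :
    ∀ᵐ q ∂(μ.prod (ν.restrict I)), q.2 ∈ I := by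
  rw [ae_iff]
  have h : {q : X × Y | ¬q.2 ∈ I} = (univ : Set X) ×ˢ Iᶜ := by
    ext q; simp
  rw [h, Measure.prod_prod, Measure.restrict_apply hI.compl, compl_inter_self, measure_empty,
    mul_zero]

/-- A bounded a.e.-strongly measurable function on `X × Y`, `Y` carrying a finite restricted
measure, which vanishes (for second coordinate in the restricting set) whenever the first
coordinate leaves a set of finite measure, is integrable for the product measure. [folklore] -/
theorem integrable_prod_restrict_of_bounded {Y : Type*} [MeasurableSpace Y] {ν : Measure Y}
    [SFinite ν] [SFinite μ] {I : Set Y} (hI : MeasurableSet I) (hνI : ν I < ⊤) {f : X × Y → ℝ}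
    (hf : AEStronglyMeasurable f (μ.prod (ν.restrict I))) {C : ℝ} (hC : ∀ q, |f q| ≤ C)
    {s : Set X} (hs : MeasurableSet s) (hμs : μ s < ⊤)
    (h0 : ∀ q, q.2 ∈ I → q.1 ∉ s → f q = 0) : Integrable f (μ.prod (ν.restrict I)) := by
  haveI : IsFiniteMeasure (ν.restrict I) := ⟨by rwa [Measure.restrict_apply_univ]⟩
  have hg : Integrable ((s ×ˢ (univ : Set Y)).indicator fun _ => |C|) (μ.prod (ν.restrict I)) := by
    refine IntegrableOn.integrable_indicator ?_ (hs.prod MeasurableSet.univ)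
    refine (integrableOn_const_iff).2 (Or.inr ?_)
    rw [Measure.prod_prod, Measure.restrict_apply_univ]
    exact ENNReal.mul_lt_top hμs hνI
  refine hg.mono' hf ?_
  filter_upwards [ae_snd_mem_prod_restrict (μ := μ) (ν := ν) hI] with q hq
  by_cases h1 : q.1 ∈ s
  · rw [indicator_of_mem (show q ∈ s ×ˢ (univ : Set Y) from ⟨h1, mem_univ _⟩),
      Real.norm_eq_abs]
    exact (hC q).trans (le_abs_self C)
  · rw [h0 q hq h1, norm_zero]
    exact indicator_nonneg (fun _ _ => abs_nonneg C) _

end Helpers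

variable {E : Type*} [NormedAddCommGroup E] [InnerProductSpace ℝ E] [FiniteDimensional ℝ E]
  [MeasurableSpace E] [BorelSpace E]

/-! ## Phase space-time as `(ℝ × E) × E` -/

section Phase

/-- Regrouping Fubini: `∫ dp ∫ dξ Φ(p, ξ) = ∫ Φ dz` over `ℝ × E × E`, for integrable `Φ`
(Mathlib's `volume_preserving_prodAssoc` and `integral_prod`). [folklore] -/
theorem integral_integral_phase {Φ : ℝ × E × E → ℝ} (hΦ : Integrable Φ volume) :
    ∫ p : ℝ × E, ∫ ξ : E, Φ (p.1, p.2, ξ) = ∫ z, Φ z := by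
  have hmp := MeasureTheory.volume_preserving_prodAssoc (α₁ := ℝ) (β₁ := E) (γ₁ := E)
  have hΦ' : Integrable (Φ ∘ MeasurableEquiv.prodAssoc) (volume : Measure ((ℝ × E) × E)) :=
    (hmp.integrable_comp_emb MeasurableEquiv.prodAssoc.measurableEmbedding).2 hΦ
  have h1 : ∫ q : (ℝ × E) × E, (Φ ∘ MeasurableEquiv.prodAssoc) q =
      ∫ p : ℝ × E, ∫ ξ : E, (Φ ∘ MeasurableEquiv.prodAssoc) (p, ξ) := integral_prod _ hΦ'
  have h2 : ∫ q : (ℝ × E) × E, (Φ ∘ MeasurableEquiv.prodAssoc) q = ∫ z, Φ z :=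
    hmp.integral_comp MeasurableEquiv.prodAssoc.measurableEmbedding Φ
  rw [← h2, h1]
  rfl

omit [InnerProductSpace ℝ E] [MeasurableSpace E] [BorelSpace E] [FiniteDimensional ℝ E] in
/-- The sup norm of a phase point controls its components. [folklore] -/
theorem norm_phase_le_iff {z : ℝ × E × E} {R : ℝ} :
    ‖z‖ ≤ R ↔ |z.1| ≤ R ∧ ‖z.2.1‖ ≤ R ∧ ‖z.2.2‖ ≤ R := by
  rw [Prod.norm_def, Prod.norm_def, max_le_iff, max_le_iff, Real.norm_eq_abs]

omit [MeasurableSpace E] [BorelSpace E] [FiniteDimensional ℝ E] [InnerProductSpace ℝ E] in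
/-- The sup norm of a base point controls its components. [folklore] -/
theorem norm_base_le_iff {p : ℝ × E} {R : ℝ} :
    ‖p‖ ≤ R ↔ |p.1| ≤ R ∧ ‖p.2‖ ≤ R := by
  rw [Prod.norm_def, max_le_iff, Real.norm_eq_abs]

end Phase

/-! ## The averaged Duhamel operator and its adjoint -/

section Defs

/-- The **averaged Duhamel operator** of velocity averaging with weight `ψ₀` and lag window
`(0, S)`: `(A F)(t, x) = ∫ ψ₀(ξ) (∫_{0<s<S} F(t - s, x - sξ, ξ) ds) dξ`, i.e. the velocity
average against `ψ₀(ξ)` of the finite-lag Duhamel integral of the source `F` (CIP 1994, p. 155: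
the velocity average `∫ uₙ dξ` of the solution of `T uₙ = Fₙ` with zero data). [cite: CIP1994, §5.3 proof of Lemma 5.3.9, p. 155] -/
def avgDuhamel (ψ₀ : E → ℝ) (S : ℝ) (F : ℝ × E × E → ℝ) (p : ℝ × E) : ℝ :=
  ∫ ξ, ψ₀ ξ * ∫ s in Ioo (0 : ℝ) S, F (shear s (p.1, p.2, ξ))

/-- The **formal adjoint** of `avgDuhamel ψ₀ S`:
`(A* G)(t', y, ξ) = ψ₀(ξ) ∫_{0<s<S} G(t' + s, y + sξ) ds`. [folklore] -/
def adjAvgDuhamel (ψ₀ : E → ℝ) (S : ℝ) (G : ℝ × E → ℝ) (z : ℝ × E × E) : ℝ :=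
  ψ₀ z.2.2 * ∫ s in Ioo (0 : ℝ) S, G (z.1 + s, z.2.1 + s • z.2.2)

/-- Unfolding of `avgDuhamel`. [folklore] -/
theorem avgDuhamel_apply (ψ₀ : E → ℝ) (S : ℝ) (F : ℝ × E × E → ℝ) (p : ℝ × E) :
    avgDuhamel ψ₀ S F p = ∫ ξ, ψ₀ ξ * ∫ s in Ioo (0 : ℝ) S, F (shear s (p.1, p.2, ξ)) := rfl

omit [FiniteDimensional ℝ E] [MeasurableSpace E] [BorelSpace E] in
/-- Unfolding of `adjAvgDuhamel`. [folklore] -/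
theorem adjAvgDuhamel_apply (ψ₀ : E → ℝ) (S : ℝ) (G : ℝ × E → ℝ) (z : ℝ × E × E) :
    adjAvgDuhamel ψ₀ S G z = ψ₀ z.2.2 * ∫ s in Ioo (0 : ℝ) S, G (z.1 + s, z.2.1 + s • z.2.2) :=
  rfl

/-- **`A F` is the velocity average of the source Duhamel integral**: if `F` vanishes for times
`≤ a` and `p.1 - a ≤ S`, then `avgDuhamel ψ₀ S F p = ∫ (sourceDuhamel F)(p, ξ) ψ₀(ξ) dξ`
(`velocityIntegral` of `VelocityAveraging`). [folklore] -/
theorem avgDuhamel_eq_velocityIntegral_sourceDuhamel {ψ₀ : E → ℝ} {S a : ℝ}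
    {F : ℝ × E × E → ℝ} (hF : ∀ z, z.1 ≤ a → F z = 0) {p : ℝ × E} (hp : p.1 - a ≤ S) :
    avgDuhamel ψ₀ S F p = velocityIntegral (fun z => ψ₀ z.2.2) (sourceDuhamel F) p := by
  rw [avgDuhamel_apply, velocityIntegral]
  refine integral_congr_ae (ae_of_all _ fun ξ => ?_)
  dsimp only
  rw [sourceDuhamel_eq_setIntegral_Ioo hF (p.1, p.2, ξ) (S := S) hp, mul_comm]

/-- **Translation covariance**: translating the source in `(t, x)` translates `A F`. [folklore] -/
theorem avgDuhamel_translate (ψ₀ : E → ℝ) (S : ℝ) (F : ℝ × E × E → ℝ) (h p : ℝ × E) :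
    avgDuhamel ψ₀ S (fun z => F (z.1 - h.1, z.2.1 - h.2, z.2.2)) p = avgDuhamel ψ₀ S F (p - h) := by
  have key : ∀ (s : ℝ) (ξ : E),
      (((shear s (p.1, p.2, ξ)).1 - h.1, (shear s (p.1, p.2, ξ)).2.1 - h.2,
        (shear s (p.1, p.2, ξ)).2.2) : ℝ × E × E) = shear s ((p - h).1, (p - h).2, ξ) := by
    intro s ξ
    simp only [shear, Prod.fst_sub, Prod.snd_sub]
    refine Prod.ext ?_ (Prod.ext ?_ rfl)
    · simp only; ring
    · simp only; abel
  simp only [avgDuhamel_apply]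
  congr 1
  funext ξ
  congr 1
  refine integral_congr_ae (ae_of_all _ fun s => ?_)
  dsimp only
  rw [key]

/-- `A` is additive in the source wherever both lag integrals converge absolutely; in
particular pointwise for bounded sources (used through `avgDuhamel_sub`). [folklore] -/
theorem avgDuhamel_sub {ψ₀ : E → ℝ} (hψm : Measurable ψ₀) {Cψ : ℝ} (hψb : ∀ ξ, |ψ₀ ξ| ≤ Cψ)
    {r : ℝ} (hψr : ∀ ξ, r < ‖ξ‖ → ψ₀ ξ = 0) {S : ℝ}
    {F₁ F₂ : ℝ × E × E → ℝ} (h₁m : Measurable F₁) (h₂m : Measurable F₂) {B : ℝ}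
    (h₁b : ∀ z, |F₁ z| ≤ B) (h₂b : ∀ z, |F₂ z| ≤ B) (p : ℝ × E) :
    avgDuhamel ψ₀ S (fun z => F₁ z - F₂ z) p = avgDuhamel ψ₀ S F₁ p - avgDuhamel ψ₀ S F₂ p := by
  have hB : 0 ≤ B := (abs_nonneg _).trans (h₁b 0)
  -- inner integrability (bounded on a finite interval)
  have hin : ∀ (F : ℝ × E × E → ℝ), Measurable F → (∀ z, |F z| ≤ B) → ∀ ξ : E,
      IntegrableOn (fun s : ℝ => F (shear s (p.1, p.2, ξ))) (Ioo (0 : ℝ) S) volume := by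
    intro F hFm hFb ξ
    exact Measure.integrableOn_of_bounded (by simp)
      (measurable_comp_shear_left hFm _).aestronglyMeasurable
      (ae_of_all _ fun s => (Real.norm_eq_abs _).le.trans (hFb _))
  -- outer integrability (bounded with bounded support in `ξ`)
  have hout : ∀ (F : ℝ × E × E → ℝ), Measurable F → (∀ z, |F z| ≤ B) →
      Integrable (fun ξ : E => ψ₀ ξ * ∫ s in Ioo (0 : ℝ) S, F (shear s (p.1, p.2, ξ))) volume := by
    intro F hFm hFb
    have hm : AEStronglyMeasurable
        (fun ξ : E => ψ₀ ξ * ∫ s in Ioo (0 : ℝ) S, F (shear s (p.1, p.2, ξ))) volume := by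
      refine (hψm.aestronglyMeasurable.mul ?_)
      have h : Measurable fun q : E × ℝ => F (shear q.2 (p.1, p.2, q.1)) :=
        hFm.comp (continuous_shear_uncurry.measurable.comp
          (measurable_snd.prodMk (measurable_const.prodMk (measurable_const.prodMk measurable_fst))))
      exact (h.stronglyMeasurable.integral_prod_right'
        (ν := (volume : Measure ℝ).restrict (Ioo 0 S))).aestronglyMeasurable
    refine integrable_of_bounded_of_eq_zero hm (C := Cψ * (B * (volume.real (Ioo (0 : ℝ) S))))
      (fun ξ => ?_) (s := closedBall (0 : E) r) (isCompact_closedBall _ _).measure_lt_top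
      (fun ξ hξ => ?_)
    · rw [abs_mul]
      refine mul_le_mul (hψb ξ) ?_ (abs_nonneg _) ((abs_nonneg _).trans (hψb 0))
      have h := norm_setIntegral_le_of_norm_le_const (μ := (volume : Measure ℝ))
        (s := Ioo (0 : ℝ) S) (f := fun s => F (shear s (p.1, p.2, ξ))) (C := B) (by simp)
        fun s _ => (Real.norm_eq_abs _).le.trans (hFb _)
      rwa [Real.norm_eq_abs] at h
    · rw [hψr ξ (by simpa using hξ), zero_mul]
  rw [avgDuhamel_apply, avgDuhamel_apply, avgDuhamel_apply,
    ← integral_sub (hout F₁ h₁m h₁b) (hout F₂ h₂m h₂b)]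
  refine integral_congr_ae (ae_of_all _ fun ξ => ?_)
  dsimp only
  rw [← mul_sub, ← integral_sub (hin F₁ h₁m h₁b ξ) (hin F₂ h₂m h₂b ξ)]

end Defs

/-! ## Bounds, supports and measurability -/

section Bounds

variable {ψ₀ : E → ℝ} {Cψ r S : ℝ}

/-- **Sup bound for `A F`**: `|A F| ≤ (∫ |ψ₀|) · S · B` if `|F| ≤ B` (`0 ≤ S`). [folklore] -/
theorem abs_avgDuhamel_le (hψi : Integrable ψ₀ volume) (hS : 0 ≤ S) {F : ℝ × E × E → ℝ} {B : ℝ}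
    (hFb : ∀ z, |F z| ≤ B) (p : ℝ × E) :
    |avgDuhamel ψ₀ S F p| ≤ (∫ ξ, |ψ₀ ξ|) * (S * B) := by
  rw [avgDuhamel_apply, ← MeasureTheory.integral_mul_const, ← Real.norm_eq_abs]
  refine norm_integral_le_of_norm_le (hψi.abs.mul_const _) (ae_of_all _ fun ξ => ?_)
  rw [norm_mul, Real.norm_eq_abs]
  refine mul_le_mul_of_nonneg_left ?_ (abs_nonneg _)
  have h := norm_setIntegral_le_of_norm_le_const (μ := (volume : Measure ℝ))
    (s := Ioo (0 : ℝ) S) (f := fun s => F (shear s (p.1, p.2, ξ))) (C := B) (by simp)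
    fun s _ => (Real.norm_eq_abs _).le.trans (hFb _)
  rw [Real.volume_real_Ioo_of_le hS, sub_zero] at h
  linarith [mul_comm S B]

omit [FiniteDimensional ℝ E] [MeasurableSpace E] [BorelSpace E] in
/-- **Sup bound for `A* G`**: `|A* G| ≤ Cψ · S · B` if `|ψ₀| ≤ Cψ`, `|G| ≤ B` (`0 ≤ S`). [folklore] -/
theorem abs_adjAvgDuhamel_le (hψb : ∀ ξ, |ψ₀ ξ| ≤ Cψ) (hS : 0 ≤ S) {G : ℝ × E → ℝ} {B : ℝ}
    (hGb : ∀ p, |G p| ≤ B) (z : ℝ × E × E) :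
    |adjAvgDuhamel ψ₀ S G z| ≤ Cψ * (S * B) := by
  rw [adjAvgDuhamel_apply, abs_mul]
  refine mul_le_mul (hψb _) ?_ (abs_nonneg _) ((abs_nonneg _).trans (hψb 0))
  have h := norm_setIntegral_le_of_norm_le_const (μ := (volume : Measure ℝ))
    (s := Ioo (0 : ℝ) S) (f := fun s => G (z.1 + s, z.2.1 + s • z.2.2)) (C := B) (by simp)
    fun s _ => (Real.norm_eq_abs _).le.trans (hGb _)
  rw [Real.volume_real_Ioo_of_le hS, sub_zero, Real.norm_eq_abs] at h
  linarith [mul_comm S B]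

omit [InnerProductSpace ℝ E] [MeasurableSpace E] [BorelSpace E] [FiniteDimensional ℝ E] in
/-- If `F` vanishes off the ball of radius `R` then the lag integrand at `(p, ξ)` vanishes
identically unless `‖(p, ξ)‖ ≤ R + S + S R` (lags in `(0, S)`, `0 ≤ S`, `0 ≤ R`). [folklore] -/
theorem apply_shear_eq_zero_of_norm_gt [NormedSpace ℝ E] {F : ℝ × E × E → ℝ} {R : ℝ}
    (hR : 0 ≤ R)
    (hFR : ∀ z, R < ‖z‖ → F z = 0) (hS : 0 ≤ S) {z : ℝ × E × E} (hz : R + S + S * R < ‖z‖)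
    {s : ℝ} (hs : s ∈ Ioo (0 : ℝ) S) : F (shear s z) = 0 := by
  refine hFR _ (lt_of_not_ge fun h => ?_)
  have h' : shear (-(-s)) z ∈ closedBall (0 : ℝ × E × E) R := by
    rw [neg_neg, mem_closedBall_zero_iff]; exact h
  -- reuse the geometry of `FreeTransportUniqueness` in elementary form
  rw [norm_phase_le_iff] at h
  obtain ⟨h1, h2, h3⟩ := h
  simp only [shear] at h1 h2 h3
  have ht : |z.1| ≤ R + S := by
    have := abs_sub_abs_le_abs_sub z.1 s
    have hs' : |s| ≤ S := by rw [abs_of_pos hs.1]; exact hs.2.le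
    linarith [abs_sub_comm z.1 s]
  have hx : ‖z.2.1‖ ≤ R + S * R := by
    have e : z.2.1 = (z.2.1 - s • z.2.2) + s • z.2.2 := by abel
    calc ‖z.2.1‖ = ‖(z.2.1 - s • z.2.2) + s • z.2.2‖ := by rw [← e]
      _ ≤ ‖z.2.1 - s • z.2.2‖ + ‖s • z.2.2‖ := norm_add_le _ _
      _ ≤ R + S * R := by
          rw [norm_smul, Real.norm_eq_abs, abs_of_pos hs.1]
          exact add_le_add h2 (mul_le_mul hs.2.le h3 (norm_nonneg _) hS)
  have : ‖z‖ ≤ R + S + S * R := by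
    rw [norm_phase_le_iff]
    exact ⟨by nlinarith, hx.trans (by nlinarith), h3.trans (by nlinarith)⟩
  exact absurd hz (not_lt.2 this)

/-- **Support of `A F`**: if `F` vanishes off the ball of radius `R`, then `A F` vanishes off the
ball of radius `R + S + S R` (`0 ≤ S`, `0 ≤ R`). [folklore] -/
theorem avgDuhamel_eq_zero_of_norm_gt {F : ℝ × E × E → ℝ} {R : ℝ} (hR : 0 ≤ R)
    (hFR : ∀ z, R < ‖z‖ → F z = 0) (hS : 0 ≤ S) {p : ℝ × E} (hp : R + S + S * R < ‖p‖) :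
    avgDuhamel ψ₀ S F p = 0 := by
  rw [avgDuhamel_apply]
  refine integral_eq_zero_of_ae (ae_of_all _ fun ξ => ?_)
  have hz : R + S + S * R < ‖((p.1, p.2, ξ) : ℝ × E × E)‖ := by
    refine hp.trans_le ?_
    rw [Prod.norm_def, Prod.norm_def, Prod.norm_def]
    exact max_le_max le_rfl (le_max_left _ _)
  simp only [Pi.zero_apply]
  rw [setIntegral_eq_zero_of_forall_eq_zero fun s hs =>
    apply_shear_eq_zero_of_norm_gt hR hFR hS hz hs, mul_zero]

omit [BorelSpace E] [MeasurableSpace E] [FiniteDimensional ℝ E] in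
/-- **Support of `A* G`**: if `G` vanishes off the ball of radius `R` and `ψ₀` off the ball of
radius `r`, then `A* G` vanishes off the ball of radius `R + S + S r + r` (`0 ≤ S, R, r`). [folklore] -/
theorem adjAvgDuhamel_eq_zero_of_norm_gt (hr : 0 ≤ r) (hψr : ∀ ξ, r < ‖ξ‖ → ψ₀ ξ = 0)
    {G : ℝ × E → ℝ} {R : ℝ} (hR : 0 ≤ R) (hGR : ∀ p, R < ‖p‖ → G p = 0) (hS : 0 ≤ S)
    {z : ℝ × E × E} (hz : R + S + S * r + r < ‖z‖) : adjAvgDuhamel ψ₀ S G z = 0 := by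
  rw [adjAvgDuhamel_apply]
  by_cases hξ : r < ‖z.2.2‖
  · rw [hψr _ hξ, zero_mul]
  push Not at hξ
  rw [setIntegral_eq_zero_of_forall_eq_zero fun s hs => hGR _ (lt_of_not_ge fun h => ?_),
    mul_zero]
  rw [norm_base_le_iff] at h
  obtain ⟨h1, h2⟩ := h
  simp only at h1 h2
  have hs' : |s| ≤ S := by rw [abs_of_pos hs.1]; exact hs.2.le
  have ht : |z.1| ≤ R + S := by
    have e : z.1 = (z.1 + s) - s := by ring
    calc |z.1| = |(z.1 + s) - s| := by rw [← e]
      _ ≤ |z.1 + s| + |s| := abs_sub _ _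
      _ ≤ R + S := add_le_add h1 hs'
  have hx : ‖z.2.1‖ ≤ R + S * r := by
    have e : z.2.1 = (z.2.1 + s • z.2.2) - s • z.2.2 := by abel
    calc ‖z.2.1‖ = ‖(z.2.1 + s • z.2.2) - s • z.2.2‖ := by rw [← e]
      _ ≤ ‖z.2.1 + s • z.2.2‖ + ‖s • z.2.2‖ := norm_sub_le _ _
      _ ≤ R + S * r := by
          rw [norm_smul, Real.norm_eq_abs, abs_of_pos hs.1]
          exact add_le_add h2 (mul_le_mul hs.2.le hξ (norm_nonneg _) hS)
  have : ‖z‖ ≤ R + S + S * r + r := by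
    rw [norm_phase_le_iff]
    refine ⟨by nlinarith, hx.trans (by nlinarith), hξ.trans (by nlinarith)⟩
  exact absurd hz (not_lt.2 this)

/-- `A F` is strongly measurable for measurable `ψ₀`, `F`. [folklore] -/
theorem stronglyMeasurable_avgDuhamel (hψm : Measurable ψ₀) {F : ℝ × E × E → ℝ}
    (hFm : Measurable F) : StronglyMeasurable (avgDuhamel ψ₀ S F) := by
  have h1 : Measurable fun q : (ℝ × E) × E × ℝ => F (shear q.2.2 (q.1.1, q.1.2, q.2.1)) :=
    hFm.comp (continuous_shear_uncurry.measurable.comp ((measurable_snd.comp measurable_snd).prodMk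
      ((measurable_fst.comp measurable_fst).prodMk ((measurable_snd.comp measurable_fst).prodMk
        (measurable_fst.comp measurable_snd)))))
  have h2 : StronglyMeasurable fun q : (ℝ × E) × E =>
      ∫ s in Ioo (0 : ℝ) S, F (shear s (q.1.1, q.1.2, q.2)) := by
    have h1' : Measurable fun q : ((ℝ × E) × E) × ℝ => F (shear q.2 (q.1.1.1, q.1.1.2, q.1.2)) :=
      h1.comp ((measurable_fst.comp measurable_fst).prodMk
        ((measurable_snd.comp measurable_fst).prodMk measurable_snd))
    exact h1'.stronglyMeasurable.integral_prod_right' (ν := (volume : Measure ℝ).restrict (Ioo 0 S))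
  have h3 : StronglyMeasurable fun q : (ℝ × E) × E =>
      ψ₀ q.2 * ∫ s in Ioo (0 : ℝ) S, F (shear s (q.1.1, q.1.2, q.2)) :=
    (hψm.comp measurable_snd).stronglyMeasurable.mul h2
  exact h3.integral_prod_right' (ν := (volume : Measure E))

/-- `A* G` is strongly measurable for measurable `ψ₀`, `G`. [folklore] -/
theorem stronglyMeasurable_adjAvgDuhamel (hψm : Measurable ψ₀) {G : ℝ × E → ℝ}
    (hGm : Measurable G) : StronglyMeasurable (adjAvgDuhamel ψ₀ S G) := by
  have h1 : Measurable fun q : (ℝ × E × E) × ℝ => G (q.1.1 + q.2, q.1.2.1 + q.2 • q.1.2.2) :=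
    hGm.comp (by fun_prop)
  have h2 : StronglyMeasurable fun z : ℝ × E × E =>
      ∫ s in Ioo (0 : ℝ) S, G (z.1 + s, z.2.1 + s • z.2.2) :=
    h1.stronglyMeasurable.integral_prod_right' (ν := (volume : Measure ℝ).restrict (Ioo 0 S))
  exact (hψm.comp (measurable_snd.comp measurable_snd)).stronglyMeasurable.mul h2

end Bounds

/-! ## The adjoint identity -/

section Adjoint

variable {ψ₀ : E → ℝ} {Cψ r S : ℝ}

/-- **The adjoint identity `∫ (A F) G = ∫ F (A* G)`** for bounded measurable `F`, `G`, `ψ₀` with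
bounded supports (`0 ≤ S`): Fubini on `(ℝ × E × E) × (0, S)` and, for each lag `s`, the
substitution `z = shear_{-s} w`, which preserves Lebesgue measure (`measurePreserving_shear`). [folklore] -/
theorem integral_avgDuhamel_mul_eq (hψm : Measurable ψ₀) (hψb : ∀ ξ, |ψ₀ ξ| ≤ Cψ)
    (hS : 0 ≤ S)
    {F : ℝ × E × E → ℝ} (hFm : Measurable F) {B R : ℝ} (hFb : ∀ z, |F z| ≤ B) (hR : 0 ≤ R)
    (hFR : ∀ z, R < ‖z‖ → F z = 0)
    {G : ℝ × E → ℝ} (hGm : Measurable G) {B' : ℝ} (hGb : ∀ p, |G p| ≤ B') :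
    ∫ p, avgDuhamel ψ₀ S F p * G p = ∫ z, F z * adjAvgDuhamel ψ₀ S G z := by
  have hB : 0 ≤ B := (abs_nonneg _).trans (hFb 0)
  have hCψ : 0 ≤ Cψ := (abs_nonneg _).trans (hψb 0)
  set ν : Measure ℝ := volume.restrict (Ioo (0 : ℝ) S) with hν
  haveI : IsFiniteMeasure ν := ⟨by simp [hν]⟩
  -- the integrands on `(ℝ × E × E) × ℝ` before and after the substitution
  set Φ : (ℝ × E × E) × ℝ → ℝ := fun q => ψ₀ q.1.2.2 * F (shear q.2 q.1) * G (q.1.1, q.1.2.1)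
    with hΦ_def
  set Ψ : (ℝ × E × E) × ℝ → ℝ := fun q =>
    ψ₀ q.1.2.2 * F q.1 * G (q.1.1 + q.2, q.1.2.1 + q.2 • q.1.2.2) with hΨ_def
  have hΦm : Measurable Φ :=
    ((hψm.comp (measurable_snd.comp (measurable_snd.comp measurable_fst))).mul
      (measurable_comp_shear hFm)).mul (hGm.comp (by fun_prop))
  have hΨm : Measurable Ψ :=
    ((hψm.comp (measurable_snd.comp (measurable_snd.comp measurable_fst))).mul
      (hFm.comp measurable_fst)).mul (hGm.comp (by fun_prop))
  have hbound : ∀ (a b c : ℝ), |a| ≤ Cψ → |b| ≤ B → |c| ≤ B' → |a * b * c| ≤ Cψ * B * B' := by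
    intro a b c ha hb hc
    rw [abs_mul, abs_mul]
    exact mul_le_mul (mul_le_mul ha hb (abs_nonneg _) hCψ) hc (abs_nonneg _) (mul_nonneg hCψ hB)
  have hΦi : Integrable Φ (volume.prod ν) := by
    refine integrable_prod_restrict_of_bounded measurableSet_Ioo (by simp) hΦm.aestronglyMeasurable
      (C := Cψ * B * B') (fun q => hbound _ _ _ (hψb _) (hFb _) (hGb _))
      (s := closedBall (0 : ℝ × E × E) (R + S + S * R)) measurableSet_closedBall
      (isCompact_closedBall _ _).measure_lt_top fun q hq hq1 => ?_
    rw [mem_closedBall_zero_iff, not_le] at hq1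
    rw [hΦ_def]; simp only
    rw [apply_shear_eq_zero_of_norm_gt hR hFR hS hq1 hq, mul_zero, zero_mul]
  have hΨi : Integrable Ψ (volume.prod ν) := by
    refine integrable_prod_restrict_of_bounded measurableSet_Ioo (by simp) hΨm.aestronglyMeasurable
      (C := Cψ * B * B') (fun q => hbound _ _ _ (hψb _) (hFb _) (hGb _))
      (s := closedBall (0 : ℝ × E × E) R) measurableSet_closedBall
      (isCompact_closedBall _ _).measure_lt_top fun q _ hq1 => ?_
    rw [mem_closedBall_zero_iff, not_le] at hq1
    rw [hΨ_def]; simp only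
    rw [hFR _ hq1, mul_zero, zero_mul]
  calc ∫ p, avgDuhamel ψ₀ S F p * G p
      = ∫ p : ℝ × E, ∫ ξ : E, ∫ s in Ioo (0 : ℝ) S, Φ ((p.1, p.2, ξ), s) := by
        congr 1
        funext p
        rw [avgDuhamel_apply, ← MeasureTheory.integral_mul_const]
        congr 1
        funext ξ
        rw [← MeasureTheory.integral_const_mul, ← MeasureTheory.integral_mul_const]
    _ = ∫ z, ∫ s in Ioo (0 : ℝ) S, Φ (z, s) :=
        integral_integral_phase (Φ := fun z => ∫ s in Ioo (0 : ℝ) S, Φ (z, s)) hΦi.integral_prod_left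
    _ = ∫ s in Ioo (0 : ℝ) S, ∫ z, Φ (z, s) := integral_integral_swap hΦi
    _ = ∫ s in Ioo (0 : ℝ) S, ∫ w, Ψ (w, s) := by
        refine setIntegral_congr_fun measurableSet_Ioo fun s _ => ?_
        have h := (measurePreserving_shear (E := E) (-s)).integral_comp
          (shearEquiv (-s)).measurableEmbedding (fun z => Φ (z, s))
        rw [← h]
        congr 1
        funext w
        simp only [hΦ_def, hΨ_def, shear_shear, add_neg_cancel, shear_zero]
        simp [shear]
    _ = ∫ w, ∫ s in Ioo (0 : ℝ) S, Ψ (w, s) := (integral_integral_swap hΨi).symm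
    _ = ∫ z, F z * adjAvgDuhamel ψ₀ S G z := by
        congr 1
        funext w
        rw [adjAvgDuhamel_apply, ← mul_assoc, mul_comm (F w), ← MeasureTheory.integral_const_mul]

end Adjoint

end Literature.MathematicalPhysics.KineticTheory
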